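import Summits.HubbardSuperconductivity.HubbardSuperconductivity.Theorems.NodalWardXYDefs
import Summits.HubbardSuperconductivity.HubbardSuperconductivity.Theorems.NodalWardXYPerturbedXYOrderEntire
import Summits.HubbardSuperconductivity.HubbardSuperconductivity.Theorems.NodalWardXYPerturbedXYOrderSchwarzInheritance
import Summits.HubbardSuperconductivity.HubbardSuperconductivity.Theorems.NodalWardXYPerturbedXYOrderStabilityOfTaylorBounds
import Summits.HubbardSuperconductivity.HubbardSuperconductivity.Theorems.NodalWardXYPerturbedXYOrderRealPlateauEven
import Summits.HubbardSuperconductivity.HubbardSuperconductivity.Theorems.NodalWardXYPerturbedXYOrderRealPlateauOdd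
import Summits.HubbardSuperconductivity.HubbardSuperconductivity.Theorems.NodalWardXYPerturbedXYOrderTwoPointNonneg
import Summits.HubbardSuperconductivity.HubbardSuperconductivity.Theorems.NodalWardXYPerturbedXYOrderTiltedBounds

/-!
# `PerturbedXYOrder` (stmt-HubbardSuperconductivity-10739) — line `schwarz-inheritance`, lead skeleton

Crux (route `NodalWardXY`, rank 3): `Summit.HubbardSuperconductivity.HubbardSuperconductivity.Theses.NodalWardXY.PerturbedXYOrder`
— for the classical XY model on `(ℤ/Lℤ)³` at `J ≥ J₀`, perturbed by a complex two-current kernel `K` with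
`‖K(b,b')‖ ≤ ε(1+dist)⁻⁴`: `Z_K ≠ 0` and `Re[num/Z_K/L⁶] ≥ a > 0`, uniformly in `L ≥ 2`.

Line (card `Cruxes/PerturbedXYOrder/Ideas/schwarz-inheritance.md`): the admissible class is balanced and
`z ↦ Z_L(zK)`, `z ↦ num_L(zK)` are ENTIRE (`stub_entire`, landed), so
* (Schwarz) COMPLEX STABILITY on a larger radius `ε₂` (`Z ≠ 0` and `‖cratio‖ ≤ B`, NO lower bound, NO order statement for the
  complex measure) + the REAL `K = 0` plateau `≥ a₀` give the crux at radius `ε₂ a₀/(4B)` with `a = a₀/2`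
  (`stub_schwarzInheritance`, landed);
* the `K = 0` plateau for ALL `L ≥ 2` (`realPlateau`, landed in `…Reduction.lean`): even `L ≥ 4` = Fröhlich–Simon–Spencer
  (`stub_realPlateauEven`), large odd `L` = Garban–Spencer on a free sub-box + Ginibre (`stub_realPlateauOdd`), small tori =
  Griffiths' first inequality (`stub_twoPointNonneg`) + the diagonal `≥ L⁻³` — all landed;
* complex stability itself was the single open, crux-sized stub `stub_complexStability` of revs 5–11 (≡ the crux, p106199); REV 12 (lead c12)
  reshapes it into the T-RG deliverable `stub_tiltedCorrelationBounds` (a-priori bounds on tilted LOCAL correlations; open, held by the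
  lead) + the glue `stub_complexStabilityOfTiltedBounds` (landed, `Theorems/NodalWardXYPerturbedXYOrderTiltedBounds.lean`); revs 6–8 only
  registered the seven c5 DELINEATION stubs, all landed (p119172 p119314 p119209 p119831 p119633 p119738) and removed again at rev 9;
  rev 10 registered the seven exponent-3 TIGHTNESS stubs, all landed (p120884 p120867 p121049 p121201 p120888 p120918, composition
  p122024 `perturbedXYOrder_false_with_exponent_three`) and removed again at rev 11). The card's Cauchy–Taylor route to it
  is landed as far as it goes: Gevrey-1 bounds on the Taylor coefficients at `t = 0` of `log(Z(tK)/Z(0))` (`× L³`) and of `cratio(tK)`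
  (cumulants / mixed cumulants under the REAL Gibbs state) imply it (`stub_stabilityOfTaylorBounds` +
  `complexStability_of_cumulantBounds`); proving those bounds uniformly in `L`, `J ≥ J₀` is the same open estimate
  (Balaban–O'Carroll class, unprinted).
Composition `PerturbedXYOrder_of` below re-proves, inside this work file, the landed `realPlateau` /
`perturbedXYOrder_of_complexStability` of `Theorems/NodalWardXYPerturbedXYOrderReduction.lean` (p86048/p86213) over the six landed
stub modules, so that the skeleton elaborates independently of that module's farm build; the tree theorem is the reference.

Disproof used (`Cruxes/PerturbedXYOrder/Disproof.lean`, v3): `PerturbedXYOrderAllJ` FALSE ⇒ every order/bound statement carries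
`J₀ ≤ J` (`realPlateau`, `stub_complexStability`); §3/§3a (`W_K` extensive, `|Z_K/Z_0| ~ e^{-cε²L³/J²}`) ⇒ `B` may be astronomically
large in `L`? NO — `stub_complexStability` asks `B` uniform in `L`, which is consistent because `cratio` is a RATIO (plateau
`m₀² + O(ε/J²)` in every caricature and in the MC j007909/j011137), while no smallness of `e^{W} − 1` or of `|Z_K/Z_0 − 1|` is ever
claimed; `Exp p ≤ 3` FALSE ⇒ exponent 4 enters only inside `stub_complexStability`; `Zk_ne_zero_of_small_volume` not needed.

VOCABULARY: `Bond, cube, cur, wJ, Wk, Zk, num, cratio, Admissible, perturbedXYOrder_iff` are the landed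
`Theorems/NodalWardXYDefs.lean` (p76365, namespace `…Theorems.PerturbedXYOrder`) = the crux's own lets; stub files are stated and
landed in that namespace (`Theorems/NodalWardXYPerturbedXYOrder<Stub>.lean`).
-/

noncomputable section

namespace Summit.HubbardSuperconductivity.HubbardSuperconductivity.Cruxes.PerturbedXYOrder.SchwarzLine

open MeasureTheory Literature.Probability.LatticeModels
open Summit.HubbardSuperconductivity.HubbardSuperconductivity.Theses.NodalWardXY
open Summit.HubbardSuperconductivity.HubbardSuperconductivity.Theorems.PerturbedXYOrder

/-! ### The stubs (registered on stmt-HubbardSuperconductivity-10739) — skeleton rev 23 (lead c20, 2026-08-17): the engine stub alone (rev-22 tool stubs landed) -/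

/-! Six of the seven registered stubs have LANDED (wave 1) and are imported from the tree, namespace
`…Theorems.PerturbedXYOrder`: `stub_realPlateauEven` (p77128), `stub_realPlateauOdd` (p85109), `stub_twoPointNonneg` (p82406),
`stub_entire` (p78794), `stub_schwarzInheritance` (p77112), `stub_stabilityOfTaylorBounds` (p77139); the assembly
`realPlateau` / `complexStability_of_cumulantBounds` / `perturbedXYOrder_of_cumulantBounds` is `…Reduction.lean` (p86048).
Rev 5: the last open stub is restated in its cleanest equivalent form `stub_complexStability` (= the card's Transfer C⁺; the
rev-3/4 `stub_cumulantBounds` implies it by the landed `complexStability_of_cumulantBounds` and is equivalent to it by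
Borel–Carathéodory; both ≡ the crux on a larger radius: `Cruxes/PerturbedXYOrder/DrefuteSchwarzInheritance.md` §3). -/

/-! Rev 12/13 (lead c12, 2026-08-17; rev 13 = rev 12 with the glue stub imported from the tree): the rev-5…11 stub `stub_complexStability` (≡ the crux, `perturbedXYOrder_iff_complexStability`
p106199) is RESHAPED into the T-RG deliverable in LOCAL-OBSERVABLE form plus landable glue:
* `stub_tiltedCorrelationBounds` (XL, open — held by the lead; = what the unwritten volume-uniform low-temperature /
  renormalisation-group expansion "T-RG" must output): uniform A-PRIORI bounds on the tilted pair-current expectations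
  `⟨j_b j_b'⟩_K` and the tilted two-point function `⟨cos(θ_x − θ_y)⟩_K`, `⟨F⟩_K := ∫ F w_J e^{W_K}/Z_K`, for `J ≥ J₀`, `L ≥ 2`,
  `K ∈ Adm(ε₂)` AT KERNELS WITH `Z_K ≠ 0` (bounded analytic local expectations — Balaban–O'Carroll-shaped);
* `stub_complexStabilityOfTiltedBounds` (S, glue, LANDED p141548 by the lead, `Theorems/NodalWardXYPerturbedXYOrderTiltedBounds.lean`; rev 13 imports it):
  those bounds ⇒ complex stability at the same radius with `B = C` (log-derivative continuity along the admissible ray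
  `tK`: `d/dt Z(tK) = Z(tK)·⟨W_K⟩_{tK}`, Grönwall for `1/Z(tK)`; the plateau is an average of `L⁶` tilted two-point values).
`complexStability := stub_complexStabilityOfTiltedBounds stub_tiltedCorrelationBounds` replaces the old stub in the composition.
The sibling crux `BalabanIR.BirComplexStableXYR` (stmt-14845, line `fat-gaussian-defect-calculus`, S5a/S5b) is parked at the same
missing theorem T-RG; this reshape aligns the two deliverable formats (local expectations / two-point function of the expansion). -/

/-- STUB (XL — the single open statement of the line; held by the lead): **a-priori bounds on the tilted local correlations**
(the T-RG deliverable). There are `J₀`, `ε₂ > 0`, `C > 0` such that for `J ≥ J₀`, `L ≥ 2` and every kernel `K` admissible at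
radius `ε₂` with `Z_K ≠ 0`, the complex tilted state `⟨F⟩_K = ∫_cube F w_J e^{W_K} / Z_K` has `‖⟨j_b j_{b'}⟩_K‖ ≤ C` for all bond
pairs and `‖⟨cos(θ_x − θ_y)⟩_K‖ ≤ C` for all site pairs — uniformly in the volume. Implies complex stability
(`stub_complexStabilityOfTiltedBounds`, landed) hence the crux; Gaussian (spin-wave) level: bounded operators
`∇(−JΔ − 2∇ᵀK∇)⁻¹∇ᵀ`, fine; the open content is the non-Gaussian (vortex / large-field) control uniformly in `L` — the
volume-uniform single-regime multiscale expansion for the low-temperature rotator under a complex power-law two-current tilt,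
unprinted (nearest: Balaban 1995–98 / Balaban–O'Carroll 1999, real quasi-local actions; Dimock 2009, non-compact local).
[cite: BalabanOcarroll1999, low-temperature expansion (nearest engine; the stated bound is not in print)] -/
theorem stub_tiltedCorrelationBounds :
    ∃ J₀ ε₂ C : ℝ, 0 < ε₂ ∧ 0 < C ∧ ∀ J : ℝ, J₀ ≤ J → ∀ (L : ℕ) [NeZero L], 2 ≤ L →
      ∀ K : Bond L → Bond L → ℂ, Admissible L ε₂ K → Zk J K ≠ 0 →
        (∀ b b' : Bond L,
          ‖(∫ θ in cube L, (cur b θ : ℂ) * (cur b' θ : ℂ) * (wJ J θ * Complex.exp (Wk K θ))) / Zk J K‖ ≤ C) ∧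
        (∀ x y : TorusSite 3 L,
          ‖(∫ θ in cube L, (Real.cos (θ x - θ y) : ℂ) * (wJ J θ * Complex.exp (Wk K θ))) / Zk J K‖ ≤ C) := by
  sorry

/-- STUB (S, glue — LANDED p141548, `Theorems/NodalWardXYPerturbedXYOrderTiltedBounds.lean`): **complex stability from a-priori bounds on
the tilted local correlations.** The bounds of `stub_tiltedCorrelationBounds` imply `Z_K ≠ 0 ∧ ‖num_K/Z_K/L⁶‖ ≤ B` at the same
radius (zero-freeness: no zero of `t ↦ Z(tK)` can be reached on `[0,1]` while its logarithmic derivative `⟨W_K⟩_{tK}` stays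
bounded; plateau: average of tilted two-point values). [folklore] -/
theorem stub_complexStabilityOfTiltedBounds :
    (∃ J₀ ε₂ C : ℝ, 0 < ε₂ ∧ 0 < C ∧ ∀ J : ℝ, J₀ ≤ J → ∀ (L : ℕ) [NeZero L], 2 ≤ L →
      ∀ K : Bond L → Bond L → ℂ, Admissible L ε₂ K → Zk J K ≠ 0 →
        (∀ b b' : Bond L,
          ‖(∫ θ in cube L, (cur b θ : ℂ) * (cur b' θ : ℂ) * (wJ J θ * Complex.exp (Wk K θ))) / Zk J K‖ ≤ C) ∧
        (∀ x y : TorusSite 3 L,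
          ‖(∫ θ in cube L, (Real.cos (θ x - θ y) : ℂ) * (wJ J θ * Complex.exp (Wk K θ))) / Zk J K‖ ≤ C)) →
    ∃ J₀ ε₂ B : ℝ, 0 < ε₂ ∧ 0 < B ∧ ∀ J : ℝ, J₀ ≤ J → ∀ (L : ℕ) [NeZero L], 2 ≤ L →
      ∀ K : Bond L → Bond L → ℂ, Admissible L ε₂ K → Zk J K ≠ 0 ∧ ‖cratio L J K‖ ≤ B :=
  -- LANDED p141548 (lead c12): `Theorems/NodalWardXYPerturbedXYOrderTiltedBounds.lean`
  Summit.HubbardSuperconductivity.HubbardSuperconductivity.Theorems.PerturbedXYOrder.stub_complexStabilityOfTiltedBounds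

/-! ### Rev 22 stubs of lead c20 — ALL LANDED, removed from the skeleton at rev 23 (2026-08-17)

Rev 22/22b/22c registered, next to the open engine stub, five TWIST-DECOUPLING tool stubs (the positive shadow of c19's Goldstone-pinching
edges N10 p156901 / N10′ p158891, on the crux's OWN class); all are in the tree (namespace `…Theorems.PerturbedXYOrder`) and none feeds
`PerturbedXYOrder_of`:
* `stub_twistEvenResponse` — p160907, `Theorems/NodalWardXYPerturbedXYOrderTwistEvenResponse.lean`: for `K ∈ Adm(ε)` and all `θ, g`,
  `‖½(W_K(θ+g) + W_K(θ−g)) − W_K(θ)‖ ≤ 288 ε Σ_b (1 − cos ∇_b g)` (per pair `sin a sin a'(cos u cos u' − 1) + cos a cos a' sin u sin u'`,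
  modulus `≤ (1−cos u) + (1−cos u')`; row/column sums `≤ 144ε`) — the symmetrised twist response of an admissible tilt is SECOND order and
  bounded by `288ε/J ×` the twist's own spin-wave energy, the same constant as the relative form bound `‖W_K‖ ≤ 288εΣ_b(1−cos∇_bθ)`;
* `stub_twistLipschitz` — p161441, `…TwistLipschitz.lean` (worker): the energy-norm Lipschitz bound
  `‖W_K(θ+g) − W_K(θ)‖ ≤ 288εΣ_b(1−cos∇_bg) + 576ε√(Σ_b(1−cos∇_bθ))√(Σ_b(1−cos∇_bg))` (odd part by a weighted Cauchy–Schwarz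
  `tlz_weighted_cauchy_schwarz`);
* `stub_twistReflection` — p161254, `…TwistReflection.lean` (worker): `∫_cube W_K(θ+g) w_J = ∫_cube W_K(θ−g) w_J` (spin flip `θ ↦ 2π − θ`,
  `trf_setIntegral_comp_flip`, exact — no periodicity needed);
* `stub_twistCertificateBound` — p161326, `…TwistCertificate.lean`: for every real `J`, `σ ≥ 0`, `K ∈ Adm(ε)` and EVERY twist `g`,
  `σ(⟨Re W_K⟩_J − ⟨½(Re W_K∘τ_g + Re W_K∘τ_{−g})⟩_J) − JΣ_b(1−cos∇_bg) ≤ (288εσ − J)Σ_b(1−cos∇_bg)` — `≤ 0` once `J ≥ 288εσ`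
  (`tcb_certificate_nonpos`): the two-sided twisted-Jensen functional that pinches the invariant sources of N10/N10′ from below at
  `+σa₀L³/2 − O(JL)` is void on the admissible class, for all twists (not only the axial family);
* `stub_twistExpectationShift` — p161589, `…TwistExpectationShift.lean`: `‖∫_cube (W_K(θ+g) − W_K(θ)) w_J‖ ≤ 288εΣ_b(1−cos∇_bg)·∫_cube w_J` —
  NO first-order response of an admissible tilt in the symmetric rotator state.
WHAT THEY CERTIFY: the two-CURRENT (gradient) structure of `W_K` decouples it from the Goldstone (twist) modes — linear coupling zero,
quadratic coupling dominated by the stiffness for `J > 288ε` — which is exactly what separates the (very probably true) crux from its refuted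
invariant long-range variants; it is the configuration-level input ("infrared irrelevance of the tilt") that any engine (T-RG, or the HW-layered
architecture of HANDBACK-c17 §3b) must propagate to all scales.  It does NOT bound tilted expectations (the engine stub). -/

/-! ### Rev 14 stubs of lead c18 — BOTH LANDED, removed from the skeleton at rev 15 (2026-08-17)

Rev 14 registered, next to the open engine stub, the crux strategist's negative lemma N7 / C′ (`Cruxes/PerturbedXYOrder/STRATEGY-CENSUS.md`
§Negation) and its tool, so that their proofs could land `--supports` (the rev-10/11 precedent of `stub_e3ExponentThreeFalse`); both are in the
tree (namespace `…Theorems.PerturbedXYOrder`) and neither feeds `PerturbedXYOrder_of`: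
* `stub_chargedShiftInvariance` — p151006, `Theorems/NodalWardXYPerturbedXYOrderChargedShift.lean`: global rotation invariance
  `∫_cube w_J e^{η Σ_x cos(θ_x + u)} = ∫_cube w_J e^{η Σ_x cos θ_x}` (Haar transfer to `U(1)^Λ`), with the tools `cfp_log_norm_le_of_zeroFree`
  (second-order Borel–Carathéodory pinching: `G` holomorphic zero-free on `‖z‖ < R`, `G(0) = 1`, `G'(0) = 0`, `‖G‖ ≤ e^M` ⇒
  `log ‖G(z)‖ ≤ 8M‖z‖²/R²` on `‖z‖ < R/2`), growth / evenness / quarter-turn / four-term identities of the charged partition function;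
* `stub_chargedFieldPinching` = `perturbedXYOrder_false_for_charged_field` — p151347,
  `Theorems/PerturbedXYOrder/Negative/ChargedFieldPinching.lean`:

  `¬ (∃ J₀ ε, 0 < ε ∧ ∀ J ≥ J₀, ∀ L ≥ 2, ∀ η : ℂ, ‖η‖ ≤ ε → ∫_cube w_J e^{η Σ_x cos θ_x} ≠ 0)`

  — the CHARGED (magnetic-field, non-O(2)-invariant) variant of the crux is FALSE (Lee–Yang pinching in the ordered phase: `realPlateau`
  p86048 pinches `Z(t)/Z(0) ≥ (a₀/8)e^{t√a₀L³/2}` from below, zero-freeness on a fixed disc would force `L³ ≤ 128 log(8/a₀)/(a₀ε)`).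
  Third typed edge of the crux: after `J ≥ J₀` (p73198) and the decay exponent `4` (p122024), the O(2)-INVARIANCE of `W_K` is
  load-bearing — no method that sees only "`‖W‖ ≤ CεL³`, entire in the coupling, `J ≥ J₀`" can prove `PerturbedXYOrder`. -/

/-! ### Rev 16 stubs of lead c18 (cycle 2) — ALL LANDED, removed from the skeleton at rev 17 (2026-08-17)

Rev 16 registered three stubs for the second negative lemma N7′ ("relative boundedness does not rescue a charged tilt"); all are in the tree
(namespace `…Theorems.PerturbedXYOrder`) and none feeds `PerturbedXYOrder_of`:
* `stub_rotatorWardIdentity` — p153040, `Theorems/NodalWardXYPerturbedXYOrderWardIdentity.lean`: the **rotator Ward identity**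
  `∫ cos(θ_x − θ_y) w_J = J ∫ sin(θ_x − θ_y) S_x w_J` (`x ≠ y`, `S_x = Σ_b sin ∇_bθ (δ_{x,b₂} − δ_{x,b₁}) = −∂_x Σ cos ∇θ`), by integration by parts
  on the angle cube (`cfw_setIntegral_deriv_eq_zero`: Haar-rotation invariance of one coordinate + differentiation under the integral), with
  `cfw_sum_sin_S` (`Σ_x sin(θ_x − c) S_x = Σ_b (cos(θ_{b₁} − c) + cos(θ_{b₂} − c))(1 − cos ∇_bθ)`) and `cfw_ward_sum`
  (`J Σ_{x,y} ∫ sin(θ_x − θ_y) S_x w_J = Σ_{x,y} ∫ cos(θ_x − θ_y) w_J − N ∫ w_J`: long-range order forces bond currents to align with the magnetisation);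
* `stub_energyTiltShift` — p153101, `Theorems/NodalWardXYPerturbedXYOrderEnergyTiltShift.lean`: rotation covariance, evenness, quarter turns, growth,
  four-term identity of `Z(η) = ∫ w_J e^{ηA}`, the pointwise pinching inequality, and the relative bound `|A| ≤ 2 Σ_b (1 − cos ∇_bθ)`;
* `stub_chargedEnergyTiltPinching` = `perturbedXYOrder_false_for_charged_energy_tilt` — p153499,
  `Theorems/PerturbedXYOrder/Negative/ChargedEnergyTiltPinching.lean`:

  `¬ (∃ J₀ ε, 0 < ε ∧ ∀ J ≥ J₀, ∀ L ≥ 2, ∀ η : ℂ, ‖η‖ ≤ ε → ∫_cube w_J e^{η Σ_b (cos θ_{b₁} + cos θ_{b₂})(1 − cos ∇_bθ)} ≠ 0)`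

  — the LOCAL, RELATIVELY (form-)BOUNDED, charge-one energy tilt is not uniformly zero-free either (pinching as in p151347; the exponential lower
  bound on the real axis, `4Z(t) ≥ (a₀/96J) e^{t a₀ N/(4J)} Z(0)`, comes from the Ward identity + `realPlateau`).  With p151347 this certifies:
  "`|W| ≤ C Σ_b (1 − cos ∇_bθ)` (Balaban's relative bound), local, entire in the coupling, `J ≥ J₀`" does NOT suffice — the O(2)-INVARIANCE of
  `W_K` is what is load-bearing in `PerturbedXYOrder` (and, in spirit, hypothesis (U1) `Σ_w n_w = 0` of the sibling `BirComplexStableXYR`). -/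

/-! ### Rev 18 stubs of lead c19 — ALL LANDED, removed from the skeleton at rev 19 (2026-08-17)

Rev 18 registered, next to the open engine stub, the negative lemma N10 of lead c19 and its tools (rev-10/11/14/16 precedent); all are in the
tree (namespace `…Theorems.PerturbedXYOrder`) and none feeds `PerturbedXYOrder_of`:
* `stub_twistedJensenSymm` — p156616, `Theorems/NodalWardXYPerturbedXYOrderTwistBound.lean`: Jensen in tangent form (`gp_jensen`) and the
  **symmetrised twisted Gibbs variational bound** `log ⟨e^F⟩_J ≥ ⟨½(F∘τ_g + F∘τ_{−g})⟩_J − J Σ_b (1 − cos ∇_b g)` for every site-dependent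
  rotation `g` (Mermin–Wagner twist as a trial state; `cfw_setIntegral_rotate`);
* `stub_characterSumBound` — p156624, `Theorems/NodalWardXYPerturbedXYOrderCharacterSum.lean`: the axial twists `g_k = 2πk x₀/L`, their cost
  `L³(1 − cos 2πk/L) ≤ 2π²k²L`, and the **character-sum bound** `Σ_{k≤m} Σ_{x,y} cos(θ_x − θ_y) cos(g_k x − g_k y) ≤ L⁶` (`m < L`;
  orthogonality of the characters of `ℤ/Lℤ`, each `k`-term `= ½(|M_k|² + |M_{−k}|²) ≥ 0`);
* `stub_twistedJensenBound` — p156785, `Theorems/NodalWardXYPerturbedXYOrderMeanFieldBounds.lean`: for the mean-field source `S = Σ_{x,y} cos(θ_x − θ_y)`,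
  `log ⟨e^{σS/L³}⟩_J ≥ σ L³ Re(cratio L J 0)` and `log ⟨e^{−σS/L³}⟩_J ≥ −σL³/m − 2π²m²JL` (`J, σ ≥ 0`, `1 ≤ m < L`);
* `stub_invariantMeanFieldPinching` = `perturbedXYOrder_false_for_invariant_meanField_source` — p156901,
  `Theorems/PerturbedXYOrder/Negative/InvariantMeanFieldPinching.lean`:

  `¬ (∃ J₀ ε, 0 < ε ∧ ∀ J ≥ J₀, ∀ L ≥ 2, ∀ s : ℂ, ‖s‖ ≤ ε → ∫_cube w_J e^{(s/L³) Σ_{x,y} cos(θ_x − θ_y)} ≠ 0)`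

  — **Goldstone pinching**: the O(2)-INVARIANT, bounded (`‖W‖ ≤ |s|L³`), per-site-summable mean-field pair source `s L³|m_L|²` is NOT
  uniformly zero-free at low temperature (`G = Z(s)Z(−s)/Z(0)²` even and zero-free ⇒ `log‖G(σ)‖ ≤ 16L³σ²/ε`, against
  `≥ σa₀L³/2 − 2π²m²JL` from Jensen + `realPlateau` and the twisted variational bound; `σ = a₀ε/64` forces `L² ≤ 512π²m²J/(a₀²ε)`).
  FOURTH typed edge of the crux, new (infrared) mechanism: among INVARIANT tilts the spatial DECAY of the kernel is load-bearing — the census'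
  "all invariant summable perturbations" (S3) is false as a class and the observable-as-source softening of the plateau half (D7) is dead,
  with zero-free radius `O(J/(a₀²L²))` as D7 predicted; what protects an admissible `W_K` is its two-CURRENT (gradient) structure. -/

/-! ### Rev 20 stubs of lead c19 (cycle 2) — ALL LANDED, removed from the skeleton at rev 21 (2026-08-17)

Rev 20 registered four stubs for the negative lemma N10′ ("relative boundedness does not rescue an invariant long-range tilt"); all are in the
tree (namespace `…Theorems.PerturbedXYOrder`) and none feeds `PerturbedXYOrder_of`:
* `stub_relTwistedSourceBound` — p158080, `Theorems/NodalWardXYPerturbedXYOrderRelTwistAlgebra.lean`: pointwise control of the symmetrised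
  twist of the Ward source `R(θ) = Σ_y Σ_b (cos(θ_{b₁}−θ_y) + cos(θ_{b₂}−θ_y))(1 − cos∇_bθ)` under a site rotation `g`
  (`½(R∘τ_g + R∘τ_{−g}) = T₁ + T₂ − T₃`; AM–GM pairing bound): `½(R∘τ_g + R∘τ_{−g}) ≤ 2tE² + V(θ,g)/t + 2L³Σ_b(1−cos∇_bg) + 2L³Σ_b|sin∇_bg|`;
* `stub_relWardJensenBound` — p158403, `Theorems/NodalWardXYPerturbedXYOrderRelWardBound.lean`: relative form-boundedness
  `|R| ≤ 2L³Σ_b(1−cos∇_bθ)`, the Ward side `J∫R w_J = Σ_{x,y}∫cos(θ_x−θ_y)w_J − L³∫w_J` (p153040) and `log⟨e^{σR/L³}⟩_J ≥ σ(L³Re cratio − 1)/J`;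
* `stub_relTwistedJensenBound` — p158639, `Theorems/NodalWardXYPerturbedXYOrderRelTwistedBounds.lean`:
  `log⟨e^{−σR/L³}⟩_J ≥ −18σL³/n − 4π²σn⁴L − 4πσn²L² − 2π²n⁴JL` (twists `g_k`, `k ≤ n² < L`, AM–GM weight `t = 1/(6n)` against the
  character-sum bound p156624);
* `stub_invariantRelBoundedPinching` = `perturbedXYOrder_false_for_invariant_relBounded_source` — p158891,
  `Theorems/PerturbedXYOrder/Negative/InvariantRelBoundedPinching.lean`:

  `¬ (∃ J₀ ε, 0 < ε ∧ ∀ J ≥ J₀, ∀ L ≥ 2, ∀ s : ℂ, ‖s‖ ≤ ε → ∫_cube w_J e^{(s/L³) R} ≠ 0)`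

  — the O(2)-INVARIANT, RELATIVELY FORM-BOUNDED (`|W| ≤ 2|s|Σ_b(1−cos∇_bθ)`: Balaban's small/large-field class, exactly what the crux
  advertises for `W_K`), mean-field-range source is NOT uniformly zero-free (Goldstone pinching: `log‖G(σ)‖ ≤ 192L³σ²/ε` against the
  Ward–Jensen side `σ(a₀L³−1)/J` and the twisted side; `L ≤ 4JC₀/a₀`).  With N10 (p156901): among invariant tilts — bounded or relatively
  bounded — the spatial DECAY of the kernel is load-bearing in `PerturbedXYOrder`; engine statements must carry a decay / quasi-locality norm. -/

/-- **Complex stability** (the rev-5…11 stub, now a corollary of the two rev-12 stubs): `Z_K ≠ 0 ∧ ‖num_K/Z_K/L⁶‖ ≤ B`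
uniformly, for `J ≥ J₀`, `L ≥ 2`, `K ∈ Adm(ε₂)`. ≡ the crux (`perturbedXYOrder_iff_complexStability`, p106199). -/
theorem complexStability :
    ∃ J₀ ε₂ B : ℝ, 0 < ε₂ ∧ 0 < B ∧ ∀ J : ℝ, J₀ ≤ J → ∀ (L : ℕ) [NeZero L], 2 ≤ L →
      ∀ K : Bond L → Bond L → ℂ, Admissible L ε₂ K → Zk J K ≠ 0 ∧ ‖cratio L J K‖ ≤ B :=
  stub_complexStabilityOfTiltedBounds stub_tiltedCorrelationBounds

/-! ### Delineation theorems of lead c5 (rev 6–8 stubs) — ALL LANDED, removed from the skeleton at rev 9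

Registered as stubs at rev 6–8, proved by two worker waves + the lead, landed `--supports` (namespace `…Theorems.PerturbedXYOrder`):
* `stub_ginibreRay` — p119172, `Theorems/NodalWardXYPerturbedXYOrderGinibreRay.lean`: on the non-positive real diagonal cone
  `K = −diag κ`, `κ ≥ 0`, the crux's conclusion holds UNIFORMLY IN `L` at every amplitude (Ginibre II + `realPlateau`);
* `stub_reflectionOddReal` — p119314, `…ReflectionOdd.lean`: `K` imaginary with `W_K` odd under `θ ↦ θ∘R`, `R x = (−x₀,x₁,x₂)`
  ⇒ `Z_K`, `num_K` real;
* `stub_oddKernelExample` — p119209, `…OddKernelExample.lean`: the admissible local kernel `K₀((x,0),(x',1)) = i(δ_{x',x}+δ_{x',x+e₀})`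
  is in that class (`(εt)K₀ ∈ Adm(ε)` for `|t| ≤ 1/16`);
* `stub_oddKernelSign`, `stub_oddKernelExampleSign` — p119831, `…OddKernelSign.lean`: crux ⇒ `0 < Re Z_K` on the admissible
  imaginary `R`-odd class (IVT along `s ↦ sK`), explicitly `0 < Re Z_{εtK₀}`: zero-freeness there is the SIGN of
  `E_{J,L} cos(Im W_K)` — the refuter-facing real target;
* `stub_linearResponseOfCrux` — p119633, `…LinearResponse.lean`: crux ⇒ `‖∂_t cratio L J (t•K)|₀‖ ≤ C` uniformly (Cauchy estimate);
* `stub_derivCratioZero` — p119738, `…DerivCratio.lean`: that derivative is `(num₁Z_0 − num_0Z₁)/Z_0²/L⁶ = L⁻⁶Cov_{J,L}(|M|², W_K)/…`,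
  so the crux contains the order-`ε¹` real-measure statement "LinearResponseXY3" (HANDBACK-c5.md §2.3), filed as milestone M1.
None of them feeds `PerturbedXYOrder_of`; they are not imported here only to keep the skeleton independent of the farm build of
freshly landed modules. -/

/-! ### Elementary facts used by the composition (proved) -/

variable {L : ℕ}

/-- `W_0 = 0`. -/
theorem Wk_zero [NeZero L] (θ : TorusSite 3 L → ℝ) : Wk (0 : Bond L → Bond L → ℂ) θ = 0 := by
  simp [Wk]

/-- The real (unperturbed) weight `e^{J Σ cos}`. -/
def w0 [NeZero L] (J : ℝ) (θ : TorusSite 3 L → ℝ) : ℝ :=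
  Real.exp (J * ∑ b : Bond L, Real.cos (θ (b.1 + Pi.single b.2 1) - θ b.1))

theorem continuous_w0 [NeZero L] (J : ℝ) : Continuous (w0 (L := L) J) := by
  unfold w0; fun_prop

theorem w0_pos [NeZero L] (J : ℝ) (θ : TorusSite 3 L → ℝ) : 0 < w0 J θ := Real.exp_pos _

theorem isCompact_cube : IsCompact (cube L) := isCompact_univ_pi fun _ => isCompact_Icc

theorem volume_cube_pos [NeZero L] : 0 < MeasureTheory.volume (cube L) := by
  unfold cube
  rw [MeasureTheory.volume_pi_pi]
  refine pos_iff_ne_zero.2 (Finset.prod_ne_zero_iff.2 fun x _ => ?_)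
  rw [Real.volume_Icc]
  exact (ENNReal.ofReal_pos.2 (by linarith [Real.pi_pos])).ne'

/-- `Z_0` is the (complexified) integral of the positive real weight. -/
theorem Zk_zero_eq [NeZero L] (J : ℝ) :
    Zk J (0 : Bond L → Bond L → ℂ) = ((∫ θ in cube L, w0 J θ : ℝ) : ℂ) := by
  unfold Zk
  have : (fun θ : TorusSite 3 L → ℝ => wJ J θ * Complex.exp (Wk (0 : Bond L → Bond L → ℂ) θ)) =
      fun θ => ((w0 J θ : ℝ) : ℂ) := by
    funext θ; rw [Wk_zero, Complex.exp_zero, mul_one]; rfl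
  rw [this, integral_complex_ofReal]

/-- The real unperturbed partition function is positive. -/
theorem integral_w0_pos [NeZero L] (J : ℝ) : 0 < ∫ θ in cube L, w0 (L := L) J θ := by
  have hint : IntegrableOn (w0 (L := L) J) (cube L) volume :=
    (continuous_w0 J).continuousOn.integrableOn_compact isCompact_cube
  rw [integral_pos_iff_support_of_nonneg (fun θ => (w0_pos J θ).le) hint]
  have hsupp : Function.support (w0 (L := L) J) = Set.univ :=
    Set.eq_univ_of_forall fun θ => (w0_pos J θ).ne'
  rw [hsupp, Measure.restrict_apply_univ]
  exact volume_cube_pos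

/-- `Z_0 ≠ 0`. -/
theorem Zk_zero_ne_zero [NeZero L] (J : ℝ) : Zk J (0 : Bond L → Bond L → ℂ) ≠ 0 := by
  rw [Zk_zero_eq, Ne, Complex.ofReal_eq_zero]
  exact (integral_w0_pos J).ne'

/-- The numerator at `K = 0` is the (complexified) real integral `Σ_{x,y} ∫ cos(θ_x − θ_y) w_0`. -/
theorem num_zero_eq [NeZero L] (J : ℝ) :
    num J (0 : Bond L → Bond L → ℂ) =
      ((∑ x : TorusSite 3 L, ∑ y : TorusSite 3 L, ∫ θ in cube L, Real.cos (θ x - θ y) * w0 J θ : ℝ) : ℂ) := by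
  have hxy : ∀ x y : TorusSite 3 L,
      (∫ θ in cube L, (Real.cos (θ x - θ y) : ℂ) * (wJ J θ * Complex.exp (Wk (0 : Bond L → Bond L → ℂ) θ))) =
        ((∫ θ in cube L, Real.cos (θ x - θ y) * w0 J θ : ℝ) : ℂ) := by
    intro x y
    have h : (fun θ : TorusSite 3 L → ℝ =>
        (Real.cos (θ x - θ y) : ℂ) * (wJ J θ * Complex.exp (Wk (0 : Bond L → Bond L → ℂ) θ))) =
        fun θ => ((Real.cos (θ x - θ y) * w0 J θ : ℝ) : ℂ) := by
      funext θ; rw [Wk_zero, Complex.exp_zero, mul_one, Complex.ofReal_mul]; rfl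
    rw [h, integral_complex_ofReal]
  unfold num
  rw [Complex.ofReal_sum]
  refine Finset.sum_congr rfl fun x _ => ?_
  rw [Complex.ofReal_sum]
  exact Finset.sum_congr rfl fun y _ => hxy x y

/-- `|Σ_{x,y} ∫ cos(θ_x − θ_y) w_0| ≤ L⁶ ∫ w_0`. -/
theorem abs_num_zero_le [NeZero L] (J : ℝ) :
    |∑ x : TorusSite 3 L, ∑ y : TorusSite 3 L, ∫ θ in cube L, Real.cos (θ x - θ y) * w0 J θ| ≤
      (L : ℝ) ^ 6 * ∫ θ in cube L, w0 (L := L) J θ := by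
  have hint : IntegrableOn (w0 (L := L) J) (cube L) volume :=
    (continuous_w0 J).continuousOn.integrableOn_compact isCompact_cube
  have hterm : ∀ x y : TorusSite 3 L,
      |∫ θ in cube L, Real.cos (θ x - θ y) * w0 J θ| ≤ ∫ θ in cube L, w0 (L := L) J θ := by
    intro x y
    have hci : IntegrableOn (fun θ : TorusSite 3 L → ℝ => Real.cos (θ x - θ y) * w0 J θ) (cube L) volume := by
      refine Continuous.continuousOn ?_ |>.integrableOn_compact isCompact_cube
      exact (by fun_prop : Continuous fun θ : TorusSite 3 L → ℝ => Real.cos (θ x - θ y)).mul (continuous_w0 J)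
    calc |∫ θ in cube L, Real.cos (θ x - θ y) * w0 J θ|
        ≤ ∫ θ in cube L, |Real.cos (θ x - θ y) * w0 J θ| := abs_integral_le_integral_abs
      _ ≤ ∫ θ in cube L, w0 J θ := by
          refine integral_mono_of_nonneg (ae_of_all _ fun θ => abs_nonneg _) hint (ae_of_all _ fun θ => ?_)
          show |Real.cos (θ x - θ y) * w0 J θ| ≤ w0 J θ
          rw [abs_mul, abs_of_pos (w0_pos J θ)]
          exact mul_le_of_le_one_left (w0_pos J θ).le (Real.abs_cos_le_one _)
  calc |∑ x : TorusSite 3 L, ∑ y : TorusSite 3 L, ∫ θ in cube L, Real.cos (θ x - θ y) * w0 J θ|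
      ≤ ∑ x : TorusSite 3 L, |∑ y : TorusSite 3 L, ∫ θ in cube L, Real.cos (θ x - θ y) * w0 J θ| :=
        Finset.abs_sum_le_sum_abs _ _
    _ ≤ ∑ x : TorusSite 3 L, ∑ y : TorusSite 3 L, |∫ θ in cube L, Real.cos (θ x - θ y) * w0 J θ| :=
        Finset.sum_le_sum fun x _ => Finset.abs_sum_le_sum_abs _ _
    _ ≤ ∑ x : TorusSite 3 L, ∑ y : TorusSite 3 L, ∫ θ in cube L, w0 (L := L) J θ := by
        gcongr with x _ y _; exact hterm x y
    _ = (L : ℝ) ^ 6 * ∫ θ in cube L, w0 (L := L) J θ := by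
        simp only [Finset.sum_const, Finset.card_univ, nsmul_eq_mul, Fintype.card_fun, Fintype.card_fin, ZMod.card]
        push_cast; ring

/-- `‖cratio L J 0‖ ≤ 1` (the real plateau is an average of cosines under a probability measure). -/
theorem norm_cratio_zero_le_one [NeZero L] (J : ℝ) : ‖cratio L J (0 : Bond L → Bond L → ℂ)‖ ≤ 1 := by
  have hZ := integral_w0_pos (L := L) J
  have hL : (0:ℝ) < (L : ℝ) ^ 6 := by
    have := NeZero.pos L; positivity
  unfold cratio
  rw [num_zero_eq, Zk_zero_eq, norm_div, norm_div, Complex.norm_real, Complex.norm_real, Real.norm_eq_abs,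
    Real.norm_eq_abs, abs_of_pos hZ]
  have : ‖((L : ℂ)) ^ 6‖ = (L : ℝ) ^ 6 := by simp
  rw [this, div_div, div_le_one (by positivity), mul_comm]
  exact abs_num_zero_le J

/-- Small tori: if all two-point functions are non-negative then the plateau is at least the diagonal contribution `L⁻³`. -/
theorem inv_cube_le_re_cratio_zero [NeZero L] {J : ℝ}
    (hnn : ∀ x y : TorusSite 3 L, 0 ≤ ∫ θ in cube L, Real.cos (θ x - θ y) * w0 J θ) :
    ((L : ℝ) ^ 3)⁻¹ ≤ (cratio L J (0 : Bond L → Bond L → ℂ)).re := by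
  have hZ := integral_w0_pos (L := L) J
  have hL0 : (0:ℝ) < (L : ℝ) := by exact_mod_cast NeZero.pos L
  have hre : (cratio L J (0 : Bond L → Bond L → ℂ)).re =
      (∑ x : TorusSite 3 L, ∑ y : TorusSite 3 L, ∫ θ in cube L, Real.cos (θ x - θ y) * w0 J θ) /
        (∫ θ in cube L, w0 (L := L) J θ) / (L : ℝ) ^ 6 := by
    unfold cratio
    rw [num_zero_eq, Zk_zero_eq]
    have : ((L : ℂ)) ^ 6 = (((L : ℝ) ^ 6 : ℝ) : ℂ) := by push_cast; ring
    rw [this, ← Complex.ofReal_div, ← Complex.ofReal_div, Complex.ofReal_re]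
  -- diagonal terms: `∫ cos 0 · w0 = Z₀`
  have hdiag : ∀ x : TorusSite 3 L, ∫ θ in cube L, Real.cos (θ x - θ x) * w0 J θ = ∫ θ in cube L, w0 (L := L) J θ := by
    intro x; refine integral_congr_ae (ae_of_all _ fun θ => ?_); simp
  have hsum : (L : ℝ) ^ 3 * ∫ θ in cube L, w0 (L := L) J θ ≤
      ∑ x : TorusSite 3 L, ∑ y : TorusSite 3 L, ∫ θ in cube L, Real.cos (θ x - θ y) * w0 J θ := by
    calc (L : ℝ) ^ 3 * ∫ θ in cube L, w0 (L := L) J θ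
        = ∑ x : TorusSite 3 L, ∫ θ in cube L, Real.cos (θ x - θ x) * w0 J θ := by
          simp only [hdiag, Finset.sum_const, Finset.card_univ, nsmul_eq_mul, Fintype.card_fun, Fintype.card_fin,
            ZMod.card]
          push_cast; ring
      _ ≤ ∑ x : TorusSite 3 L, ∑ y : TorusSite 3 L, ∫ θ in cube L, Real.cos (θ x - θ y) * w0 J θ := by
          refine Finset.sum_le_sum fun x _ => ?_
          rw [← Finset.add_sum_erase _ _ (Finset.mem_univ x)]
          exact le_add_of_nonneg_right (Finset.sum_nonneg fun y _ => hnn x y)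
  rw [hre, le_div_iff₀ (by positivity), le_div_iff₀ hZ]
  calc ((L : ℝ) ^ 3)⁻¹ * (L : ℝ) ^ 6 * ∫ θ in cube L, w0 (L := L) J θ
      = (L : ℝ) ^ 3 * ∫ θ in cube L, w0 (L := L) J θ := by field_simp
    _ ≤ _ := hsum

/-! ### Composition (sorry-free modulo the stubs) -/

/-- The unperturbed plateau for every torus `L ≥ 2` (work-file copy of the landed `realPlateau`). -/
theorem realPlateau' :
    ∃ J₁ a₀ : ℝ, 0 < a₀ ∧ ∀ J : ℝ, J₁ ≤ J → ∀ (L : ℕ) [NeZero L], 2 ≤ L → a₀ ≤ (cratio L J 0).re := by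
  obtain ⟨J₁, a₁, ha₁, hE⟩ := stub_realPlateauEven
  obtain ⟨J₂, a₂, L₁, ha₂, hO⟩ := stub_realPlateauOdd
  set a₃ : ℝ := ((max L₁ 4 : ℕ) : ℝ)⁻¹ ^ 3 with ha₃def
  have ha₃ : 0 < a₃ := by positivity
  refine ⟨max (max J₁ J₂) 0, min (min a₁ a₂) a₃, by positivity, fun J hJ L _ hL => ?_⟩
  have hJ₁ : J₁ ≤ J := le_trans (le_trans (le_max_left J₁ J₂) (le_max_left _ 0)) hJ
  have hJ₂ : J₂ ≤ J := le_trans (le_trans (le_max_right J₁ J₂) (le_max_left _ 0)) hJ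
  have hJ0 : 0 ≤ J := le_trans (le_max_right _ 0) hJ
  by_cases h : Even L ∧ 4 ≤ L
  · exact (min_le_left _ _).trans ((min_le_left _ _).trans (hE J hJ₁ L h.1 h.2))
  by_cases h' : Odd L ∧ L₁ ≤ L
  · exact (min_le_left _ _).trans ((min_le_right _ _).trans (hO J hJ₂ L h'.1 h'.2))
  have hsmall : L < max L₁ 4 := by
    rcases Nat.even_or_odd L with he | ho
    · have : ¬ 4 ≤ L := fun h4 => h ⟨he, h4⟩
      omega
    · have : ¬ L₁ ≤ L := fun h1 => h' ⟨ho, h1⟩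
      omega
  refine (min_le_right _ _).trans (le_trans ?_ (inv_cube_le_re_cratio_zero fun x y => ?_))
  · rw [ha₃def, inv_pow]
    have hL0 : (0:ℝ) < (L : ℝ) := by exact_mod_cast NeZero.pos L
    have hle : (L : ℝ) ≤ ((max L₁ 4 : ℕ) : ℝ) := by exact_mod_cast hsmall.le
    exact inv_anti₀ (by positivity) (pow_le_pow_left₀ hL0.le hle 3)
  · exact stub_twoPointNonneg J hJ0 L x y

/-- **The crux from the open stub** (work-file copy of the landed `perturbedXYOrder_of_complexStability`, applied to
`complexStability` = glue ∘ `stub_tiltedCorrelationBounds`): real plateau `a₀` for all `L ≥ 2` · complex stability at radius `ε₂` with bound `B` · Schwarz inheritance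
⇒ `PerturbedXYOrder` with `ε = ε₂ a₀/(4B)`, `a = a₀/2`. -/
theorem PerturbedXYOrder_of : PerturbedXYOrder := by
  rw [perturbedXYOrder_iff]
  obtain ⟨J₀, ε₂, B, hε₂, hB, hCS⟩ := complexStability
  obtain ⟨J₁, a₀, ha₀, hplat⟩ := realPlateau'
  refine ⟨max J₀ J₁, ε₂ * a₀ / (4 * B), a₀ / 2, by positivity, by positivity, ?_⟩
  intro J hJ L _ hL K hK
  exact stub_schwarzInheritance J L ε₂ B a₀ hε₂ ha₀ (fun K' => stub_entire J L K')
    (hCS J (le_trans (le_max_left _ _) hJ) L hL) (hplat J (le_trans (le_max_right _ _) hJ) L hL) K hK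

/-! ### Tightness in the decay exponent (rev 10 stubs, lead c5) — ALL LANDED, removed from the skeleton at rev 11

Disproof.lean §2 recorded the PAPER verdict that the crux with envelope `(1+dist)⁻³` (`PerturbedXYOrderExp 3`) fails for every
`J₀, ε, a`.  Rev 10 registered seven stubs formalising it with an explicit block kernel; all landed `--supports`
(namespace `…Theorems.PerturbedXYOrder`): `stub_e3BlockBounds` p120884 (…Exp3BlockBounds.lean), `stub_e3L2Rigidity` p120867
(…Exp3L2Rigidity.lean), `stub_e3LocalRigidity` p121049 (…Exp3LocalRigidity.lean), `stub_e3Kernel` p121201 (…Exp3Kernel.lean),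
`stub_e3Laplace` p120888 (…Exp3Laplace.lean), `stub_e3HelixBox` p120918 (…Exp3HelixBox.lean), and the lead's composition
`stub_e3ExponentThreeFalse` = `perturbedXYOrder_false_with_exponent_three`, p122024
(`Theorems/PerturbedXYOrder/Negative/ExponentThreeNoPlateau.lean`):

  `¬ (∃ J₀ ε a, 0 < ε ∧ 0 < a ∧ ∀ J ≥ J₀, ∀ L ≥ 2, ∀ K, (∀ b b', ‖K b b'‖ ≤ ε/(1+dist)³) → Z_K ≠ 0 ∧ a ≤ Re cratio)`

— the decay exponent `4` of the crux is load-bearing from below (and `J ≥ J₀` from `perturbedXYOrder_false_without_lowT`, p73198). -/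

end Summit.HubbardSuperconductivity.HubbardSuperconductivity.Cruxes.PerturbedXYOrder.SchwarzLine

end
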